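import Literature.AlgebraicGeometry.Frobenioids.PadicFrobenioidPsiBOfEquivalenceBase
import Literature.AlgebraicGeometry.Frobenioids.ModelFrobenioidPsiBEffective
import Literature.AlgebraicGeometry.Frobenioids.BaseCategoryTheoreticityThm34HeadInstances
import HarnessLib

/-!
# Frobenioids II, Theorem 2.4 (ii) junction: the rational-function transport `Ψ_B : B₁ ⥲ B₂` over `(Ψ_Base, η)`
# CONSTRUCTED from an equivalence `Ψ` of `p`-adic Frobenioids — discharge of the `(Ψ_B, hΨB)` binder pair

Mochizuki, *The geometry of Frobenioids II*, Kyushu J. Math. **62** (2008) 401–460, §2, proof of Theorem 2.4 (i),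
p. 20 ll. 27–40: "it follows from [Mzk5], Corollaries 4.10; 4.11, (ii), (iii), that `Ψ` induces a 1-compatible
equivalence of categories `Ψ^Base : D₁ ⥲ D₂`, as well as compatible isomorphisms of functors `Φ₁ ⥲ Φ₂`, `B₁ ⥲ B₂`"
[cite: MochizukiFrdII2008, Thm 2.4 (i) p.20]; *The geometry of Frobenioids I*, Kyushu J. Math. **62** (2008)
293–400, Thm. 3.4 (iii)/(iv) pp. 62–63 ("`Ψ` preserves … `O^▷(−)`", "`Ψ^{ℕ≥1}` is the identity"), Thm. 5.2 (i)/(ii)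
pp. 100–101 (the model Frobenioid, `O^▷(A) = {b ∈ B(A_D) | Div_B(b) ≥ 0}`) [cite: MochizukiFrdI2008, Thm. 3.4 (iv) p.63].

PROOF-ONLY file (cell abc-iut, layer L1, row «T24ii-J2» piece P6, seat abc-iut-L1-d3 gen 7; L1-lead GO
2026-08-26T19:36:52Z; part 2 of 2 — the algebra, the monoprime totality and the two `O^▷`-squares are part 1,
`PadicFrobenioidPsiBOfEquivalenceBase.lean`).  The assembly of [FrdII] Thm. 2.4 (ii) over the genuine absolute bases (abc-iut-L1-t7 / -d1
pieces P3–P5) carries ONE hypothesis pair `(Ψ_B, hΨB)`: a natural isomorphism `Ψ_B : B₁ ≅ E^op ⋙ B₂` over a base functor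
`E` with `η : Ψ ⋙ Base₂ ≅ Base₁ ⋙ E`, INDUCED BY `Ψ` on `O^▷(−)`, i.e. `u_{Ψ f} = η^*(Ψ_B(u_f))` for every base-identity
linear endomorphism `f` (the letter of abc-iut-L1-d3 gen 6's `PadicFrd.Datum.hpos_of_equivalence`, p459104).  This file
CONSTRUCTS such a `Ψ_B` for EVERY equivalence `Ψ : C₁ ⥲ C₂` of `p`-adic Frobenioids over `𝓑^temp(Πᵢ)⁰ = CosetCat Πᵢ`
(`Πᵢ` temp-slim tempered) and EVERY `(E, η)`, from LANDED theorems only: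
* [FrdI] Thm. 3.4 (iv) «`Ψ` preserves `O^▷`» (`FrdI.Thm34iv_holds`, via abc-iut-L1-t7's `PadicFrd.map_mem_endSubmonoid_iff`
  on the relative data and `toRelTopFrob_map_mem_endSubmonoid_iff`);
* [FrdI] Thm. 3.4 (iii) «`Ψ` preserves Frobenius degrees» (`FrdI.preservesDegFr_ofFunctor_of_isFrobeniusSlim` at the
  relative data `dᵢ.relTop`, whose hypotheses are the tree's [FrdII] Thm. 1.2 (i) instances);
* the O-monoid dictionary of the model Frobenioid (`ModelFrobenioid.exists_intertwiner_of_linear`, `unit_eq_of_intertwine`,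
  `eq_of_mem_endSubmonoid_of_unit_eq`, `exists_mem_endSubmonoid_unit_eq_iff`);
* `Φ(X)` monoprime ⇒ every element of `B(X)` is effective or inverse-effective (`IsMonoprime.dvd_or_dvd`), so `B(X)` is
  the localization of `B^▷(X) := Div_B⁻¹(Φ(X))` at itself and Mathlib's `Submonoid.LocalizationMap` extends the
  `O^▷`-level transport `u_f ↦ (η⁻¹)^* u_{Ψ f}` uniquely to `B(X)`.
Route: at `A_X := (X, 0)` the map `f ↦ u_f` identifies `O^▷(A_X)` with `B^▷(X)`; `Ψ` carries `O^▷(A_X)` bijectively onto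
`O^▷(Ψ A_X)`; naturality in `X` along `g : X′ → X` from the square `f′ ≫ (1,g,0,1) = (1,g,0,1) ≫ f` (Prop. 1.11 (iv)),
`deg_Fr(Ψ(1,g,0,1)) = 1` and the `η`-square; the clause at an ARBITRARY object `A = (X, α)` (which need NOT be
isomorphic to `A_X`) through `A″ := (X, a)` for `α = a − b`, along the base-identity linear morphisms `(1, id, b, 1) : A → A″`
and `(1, id, a, 1) : A_X → A″`.  Main theorem `PadicFrd.Datum.exists_psiB_of_equivalence`; hypotheses = the data
`(hPᵢ, hZᵢ, Ψ, E, η)` only.  No definitions; nothing of either paper is restated or strengthened; nothing here bears on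
[IUTchIII] Cor. 3.12 (honest framing: bookkeeping over OUR typed form of [FrdII] Thm. 2.4).
-/

noncomputable section

namespace Literature.AlgebraicGeometry.Frobenioids

open CategoryTheory Opposite Function

/-! ### §0 Algebra: homomorphisms out of a commutative group generated by a "total" submonoid -/

section Algebra

variable {G : Type*} [CommMonoid G] {H : Type*} [CommMonoid H]

/-- The inclusion of a submonoid `M` of a commutative monoid `G` of units such that every element of `G` lies in
`M` or is inverse to an element of `M` is a localization map of `M` at `⊤` (used for `B^▷(X) ⊆ B(X)` of the `p`-adic
Frobenioid, [FrdI] Thm. 5.2 (ii) "`O^×(A^birat) ≅ B(A_D)`"). [folklore] -/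
private theorem Submonoid.isLocalizationMap_top_subtype_of_total (M : Submonoid G) (hG : ∀ g : G, IsUnit g)
    (hM : ∀ g : G, g ∈ M ∨ ∃ m ∈ M, g * m = 1) :
    (⊤ : Submonoid M).IsLocalizationMap (M.subtype : M → G) := by
  refine ⟨fun y => hG _, fun z => ?_, fun {x y} h => ⟨1, by rw [Subtype.ext h]⟩⟩
  rcases hM z with hz | ⟨m, hm, hzm⟩
  · exact ⟨(⟨z, hz⟩, 1), by simp⟩
  · exact ⟨(1, ⟨⟨m, hm⟩, trivial⟩), by simpa using hzm⟩

/-- Two monoid homomorphisms out of `G` that agree on a total submonoid `M` of units agree. [folklore] -/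
private theorem MonoidHom.eq_of_eqOn_of_total (M : Submonoid G) (hG : ∀ g : G, IsUnit g)
    (hM : ∀ g : G, g ∈ M ∨ ∃ m ∈ M, g * m = 1) {P : Type*} [CommMonoid P] {j k : G →* P}
    (h : ∀ m : G, m ∈ M → j m = k m) : j = k := by
  let f : (⊤ : Submonoid M).LocalizationMap G :=
    ⟨M.subtype, Submonoid.isLocalizationMap_top_subtype_of_total M hG hM⟩
  refine f.epic_of_localizationMap ?_
  ext m
  exact h m.1 m.2

/-- **Extension by totality.**  An injective monoid homomorphism `λ : M → H` from a total submonoid of units `M ⊆ G`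
whose image is a total submonoid of units of `H` extends to a multiplicative isomorphism `G ≃* H`. [folklore] -/
private theorem MulEquiv.exists_extend_of_total (M : Submonoid G) (hG : ∀ g : G, IsUnit g)
    (hM : ∀ g : G, g ∈ M ∨ ∃ m ∈ M, g * m = 1) (hH : ∀ h : H, IsUnit h) (N : Submonoid H)
    (hN : ∀ h : H, h ∈ N ∨ ∃ n ∈ N, h * n = 1) (lam : M →* H) (hinj : Injective lam)
    (himage : ∀ h : H, h ∈ N ↔ ∃ m : M, lam m = h) :
    ∃ Λ : G ≃* H, ∀ m : M, Λ m = lam m := by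
  classical
  let f : (⊤ : Submonoid M).LocalizationMap G :=
    ⟨M.subtype, Submonoid.isLocalizationMap_top_subtype_of_total M hG hM⟩
  have hg : ∀ y : (⊤ : Submonoid M), IsUnit (lam y) := fun y => hH _
  have hfeq : ∀ m : M, f m = (m : G) := fun _ => rfl
  have hinj' : Injective (f.lift hg) := by
    rw [Submonoid.LocalizationMap.lift_injective_iff]
    intro x y
    constructor
    · intro hxy
      rw [hfeq, hfeq] at hxy
      rw [Subtype.ext hxy]
    · intro hxy
      rw [hinj hxy]
  have hsurj' : Surjective (f.lift hg) := by
    rw [Submonoid.LocalizationMap.lift_surjective_iff]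
    intro v
    rcases hN v with hv | ⟨n, hn, hvn⟩
    · obtain ⟨m, hm⟩ := (himage v).mp hv
      exact ⟨(m, 1), by simpa using hm.symm⟩
    · obtain ⟨m, hm⟩ := (himage n).mp hn
      refine ⟨(1, ⟨m, trivial⟩), ?_⟩
      simpa [hm] using hvn
  refine ⟨MulEquiv.ofBijective (f.lift hg) ⟨hinj', hsurj'⟩, fun m => ?_⟩
  rw [MulEquiv.ofBijective_apply, ← hfeq, Submonoid.LocalizationMap.lift_eq]

end Algebra

namespace PadicFrd.Datum

open Literature.AnabelianGeometry.SemiGraphs QuasiTemperoid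

/-! ### §3 Two data over `CosetCat Πᵢ`: `Ψ` preserves `O^▷` and `deg_Fr`; the transport at one base object -/

section TwoData

variable {p₁ p₂ : ℕ} [Fact p₁.Prime] [Fact p₂.Prime]
  {P₁ : Type} [Group P₁] [TopologicalSpace P₁] [IsTopologicalGroup P₁] (hP₁ : IsTempered P₁) (hZ₁ : IsSlimGroup P₁)
  {d₁ : Datum (CosetCat P₁) p₁}
  {P₂ : Type} [Group P₂] [TopologicalSpace P₂] [IsTopologicalGroup P₂] (hP₂ : IsTempered P₂) (hZ₂ : IsSlimGroup P₂)
  {d₂ : Datum (CosetCat P₂) p₂}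
  (Ψ : d₁.frobenioid ≌ d₂.frobenioid)

include hP₂ hZ₂ in
/-- **[FrdI] Thm. 3.4 (iii) on the absolute data: `deg_Fr(Ψ φ) = deg_Fr(φ)`** for every morphism `φ` — the tree's
`FrdI.preservesDegFr_ofFunctor_of_isFrobeniusSlim` at the relative data `dᵢ.relTop` ([FrdII] Thm. 1.2 (i): `Cᵢ`
Frobenioids of standard type, not group-like; `𝓑^temp(Π, Π)⁰` slim), read back along `C ≌ C♭`.
[cite: MochizukiFrdI2008, Thm. 3.4 (iii) p.62] -/
theorem degFr_map_of_equivalence {A A' : d₁.frobenioid} (φ : A ⟶ A') :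
    ModelFrobenioid.degFr (Ψ.functor.map φ) = ModelFrobenioid.degFr φ := by
  have h := FrdI.preservesDegFr_ofFunctor_of_isFrobeniusSlim d₁.relTop.rel_isFrobenioid d₂.relTop.rel_isFrobenioid
    (relTopEquivalence Ψ) d₁.relTop.rel_isOfStandardType d₂.relTop.rel_isOfStandardType (hypB_rel _)
    (Datum.rel_isSlim_base hP₂ hZ₂).isFrobeniusSlim
  exact h (d₁.toRelTopFrob.map φ)

include hP₂ hZ₂ in
/-- `Ψ` carries linear morphisms to linear morphisms. [cite: MochizukiFrdI2008, Thm. 3.4 (iii) p.62] -/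
theorem degFr_map_eq_one_of_equivalence (A A' : d₁.frobenioid) (φ : A ⟶ A') (hφ : ModelFrobenioid.degFr φ = 1) :
    ModelFrobenioid.degFr (Ψ.functor.map φ) = 1 := by
  rw [degFr_map_of_equivalence hP₂ hZ₂ Ψ φ, hφ]

include hP₁ hZ₁ hP₂ hZ₂ in
/-- **[FrdI] Thm. 3.4 (iv) on the absolute data, one direction**: `Ψ` carries `O^▷(A)` into `O^▷(Ψ A)`
(abc-iut-L1-t7's `PadicFrd.map_mem_endSubmonoid_iff` at `Ψ♭`, read back along `O^▷(A♭) = O^▷(A)`).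
[cite: MochizukiFrdI2008, Thm. 3.4 (iv) p.63] -/
theorem map_mem_endSubmonoid_of_mem_abs (A : d₁.frobenioid) (f : A ⟶ A)
    (hf : f ∈ PreFrobenioid.endSubmonoid d₁.structureFunctor A) :
    Ψ.functor.map f ∈ PreFrobenioid.endSubmonoid d₂.structureFunctor (Ψ.functor.obj A) :=
  (d₂.toRelTopFrob_map_mem_endSubmonoid_iff _ _).mp
    ((PadicFrd.map_mem_endSubmonoid_iff hP₁ hZ₁ hP₂ hZ₂ (relTopEquivalence Ψ) (d₁.toRelTopFrob.obj A)
      (d₁.toRelTopFrob.map f)).mp ((d₁.toRelTopFrob_map_mem_endSubmonoid_iff _ _).mpr hf))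

include hP₁ hZ₁ hP₂ hZ₂ in
/-- … and only elements of `O^▷(A)` are carried into `O^▷(Ψ A)`. [cite: MochizukiFrdI2008, Thm. 3.4 (iv) p.63] -/
theorem mem_endSubmonoid_of_map_mem_abs (A : d₁.frobenioid) (f : A ⟶ A)
    (hf : Ψ.functor.map f ∈ PreFrobenioid.endSubmonoid d₂.structureFunctor (Ψ.functor.obj A)) :
    f ∈ PreFrobenioid.endSubmonoid d₁.structureFunctor A :=
  (d₁.toRelTopFrob_map_mem_endSubmonoid_iff _ _).mp
    ((PadicFrd.map_mem_endSubmonoid_iff hP₁ hZ₁ hP₂ hZ₂ (relTopEquivalence Ψ) (d₁.toRelTopFrob.obj A)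
      (d₁.toRelTopFrob.map f)).mpr ((d₂.toRelTopFrob_map_mem_endSubmonoid_iff _ _).mpr hf))

include hP₁ hZ₁ hP₂ hZ₂ in
/-- **The transport at ONE base object.**  For `X ∈ Ob(D₁)`, `A_X = (X, 0)` and any `(E, η)`: an isomorphism
`Λ_X : B₁(X) ⥲ B₂(E X)` with `Λ_X(u_f) = (η_{A_X}⁻¹)^* u_{Ψ f}` for every `f ∈ O^▷(A_X)` — the `O^▷`-level bijection
`u_f ↦ u_{Ψ f}` (Thm. 3.4 (iv) + Thm. 5.2 (ii)'s dictionary `O^▷(A_X) = B^▷(X)`), extended to `B(X) ⊇ B^▷(X)` by totality.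
[cite: MochizukiFrdII2008, Thm 2.4 (i) p.20] -/
theorem exists_mulEquiv_B_of_equivalence (E : CosetCat P₁ ⥤ CosetCat P₂)
    (η : Ψ.functor ⋙ ModelFrobenioid.baseFunctor d₂.Φ d₂.B d₂.divB ≅ ModelFrobenioid.baseFunctor d₁.Φ d₁.B d₁.divB ⋙ E)
    (X : CosetCat P₁) :
    ∃ Λ : d₁.B.obj (op X) ≃* d₂.B.obj (op (E.obj X)),
      ∀ f : ModelFrobenioid.zeroObj d₁.Φ d₁.B d₁.divB X ⟶ ModelFrobenioid.zeroObj d₁.Φ d₁.B d₁.divB X,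
        f ∈ PreFrobenioid.endSubmonoid d₁.structureFunctor _ →
          Λ (ModelFrobenioid.unit f) =
            (d₂.B.map (η.inv.app (ModelFrobenioid.zeroObj d₁.Φ d₁.B d₁.divB X)).op).hom
              (ModelFrobenioid.unit (Ψ.functor.map f)) := by
  classical
  -- notation
  let AX : d₁.frobenioid := ModelFrobenioid.zeroObj d₁.Φ d₁.B d₁.divB X
  let O₁ : Submonoid (End AX) := PreFrobenioid.endSubmonoid d₁.structureFunctor AX
  let O₂ : Submonoid (End (Ψ.functor.obj AX)) := PreFrobenioid.endSubmonoid d₂.structureFunctor (Ψ.functor.obj AX)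
  let T : d₂.B.obj (op (Ψ.functor.obj AX).base) →* d₂.B.obj (op (E.obj X)) := (d₂.B.map (η.inv.app AX).op).hom
  let T' : d₂.B.obj (op (E.obj X)) →* d₂.B.obj (op (Ψ.functor.obj AX).base) := (d₂.B.map (η.hom.app AX).op).hom
  have hT'T : ∀ x, T' (T x) = x := fun x => d₂.B_map_hom_inv_apply (η.app AX) x
  have hTT' : ∀ x, T (T' x) = x := fun x => d₂.B_map_hom_inv_apply (η.app AX).symm x
  let M₁ : Submonoid (d₁.B.obj (op X)) :=
    (MonoidHom.mrange (Algebra.GrothendieckGroup.of (M := d₁.Φ.obj (op X)))).comap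
      (Frobenioids.divB d₁.Φ d₁.B d₁.divB (op X))
  let M₂ : Submonoid (d₂.B.obj (op (E.obj X))) :=
    (MonoidHom.mrange (Algebra.GrothendieckGroup.of (M := d₂.Φ.obj (op (E.obj X))))).comap
      (Frobenioids.divB d₂.Φ d₂.B d₂.divB (op (E.obj X)))
  -- the endomorphism of `A_X` with a given effective rational function (Thm. 5.2 (ii) dictionary)
  have hex : ∀ m : M₁, ∃ f : AX ⟶ AX, f ∈ O₁ ∧ ModelFrobenioid.unit f = (m : d₁.B.obj (op X)) := fun m =>
    (d₁.exists_mem_endSubmonoid_unit_eq_iff AX m.1).mpr ((d₁.mem_effective_iff (op X) m.1).mp m.2)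
  choose fOf hfOf_mem hfOf_unit using hex
  have hfOf_eq : ∀ (m : M₁) (f : AX ⟶ AX), f ∈ O₁ → ModelFrobenioid.unit f = (m : d₁.B.obj (op X)) → fOf m = f :=
    fun m f hf hfu => ModelFrobenioid.eq_of_mem_endSubmonoid_of_unit_eq (d₁.isIntegral_Φ _) (hfOf_mem m) hf
      ((hfOf_unit m).trans hfu.symm)
  -- `Ψ` on `O^▷(A_X)`
  have hO : ∀ f : AX ⟶ AX, f ∈ O₁ → Ψ.functor.map f ∈ O₂ := fun f hf =>
    map_mem_endSubmonoid_of_mem_abs hP₁ hZ₁ hP₂ hZ₂ Ψ AX f hf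
  -- the `O^▷`-level transport as a homomorphism `B^▷(X) → B₂(E X)`
  let lam : M₁ →* d₂.B.obj (op (E.obj X)) :=
    { toFun := fun m => T (ModelFrobenioid.unit (Ψ.functor.map (fOf m)))
      map_one' := by
        have h1 : fOf 1 = 𝟙 AX := hfOf_eq 1 (𝟙 AX) O₁.one_mem rfl
        change T (ModelFrobenioid.unit (Ψ.functor.map (fOf 1))) = 1
        rw [h1, CategoryTheory.Functor.map_id, ModelFrobenioid.unit_id, map_one]
      map_mul' := fun m m' => by
        have hmul : fOf (m * m') = fOf m ≫ fOf m' := by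
          refine hfOf_eq (m * m') _ (O₁.mul_mem (hfOf_mem m') (hfOf_mem m)) ?_
          rw [ModelFrobenioid.unit_comp_of_mem_endSubmonoid (hfOf_mem m) (hfOf_mem m'), hfOf_unit, hfOf_unit,
            Submonoid.coe_mul, mul_comm]
        change T (ModelFrobenioid.unit (Ψ.functor.map (fOf (m * m')))) =
          T (ModelFrobenioid.unit (Ψ.functor.map (fOf m))) * T (ModelFrobenioid.unit (Ψ.functor.map (fOf m')))
        rw [hmul, CategoryTheory.Functor.map_comp,
          ModelFrobenioid.unit_comp_of_mem_endSubmonoid (hO _ (hfOf_mem m)) (hO _ (hfOf_mem m')), map_mul,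
          mul_comm] }
  have hlam : ∀ (f : AX ⟶ AX) (hf : f ∈ O₁) (hm : ModelFrobenioid.unit f ∈ M₁),
      lam ⟨ModelFrobenioid.unit f, hm⟩ = T (ModelFrobenioid.unit (Ψ.functor.map f)) := by
    intro f hf hm
    change T (ModelFrobenioid.unit (Ψ.functor.map (fOf ⟨ModelFrobenioid.unit f, hm⟩))) = _
    rw [hfOf_eq ⟨ModelFrobenioid.unit f, hm⟩ f hf rfl]
  -- injectivity: `u ↦ u_{Ψ f}` is injective on `O^▷` (faithfulness + the dictionary in `C₂`)
  have hinj : Injective lam := by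
    intro m m' h
    change T (ModelFrobenioid.unit (Ψ.functor.map (fOf m))) = T (ModelFrobenioid.unit (Ψ.functor.map (fOf m'))) at h
    have h' := congrArg T' h
    rw [hT'T, hT'T] at h'
    have h'' : Ψ.functor.map (fOf m) = Ψ.functor.map (fOf m') :=
      ModelFrobenioid.eq_of_mem_endSubmonoid_of_unit_eq (d₂.isIntegral_Φ _) (hO _ (hfOf_mem m))
        (hO _ (hfOf_mem m')) h'
    apply Subtype.ext
    rw [← hfOf_unit m, ← hfOf_unit m', Ψ.functor.map_injective h'']
  -- image = the effective submonoid `B^▷(E X)`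
  have himage : ∀ h : d₂.B.obj (op (E.obj X)), h ∈ M₂ ↔ ∃ m : M₁, lam m = h := by
    intro h
    constructor
    · intro hh
      obtain ⟨c, hc⟩ := (d₂.mem_effective_iff _ h).mp hh
      -- `T' h ∈ B₂((Ψ A_X)_D)` is effective, hence the rational function of some `g ∈ O^▷(Ψ A_X)`
      have hc' := ModelFrobenioid.of_map_eq_divB_map (Φ := d₂.Φ) (B := d₂.B) (DivB := d₂.divB) (η.hom.app AX) hc
      obtain ⟨g, hg, hgu⟩ := (d₂.exists_mem_endSubmonoid_unit_eq_iff (Ψ.functor.obj AX) (T' h)).mpr ⟨_, hc'⟩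
      -- `g = Ψ f`
      have hfg : Ψ.functor.map (Ψ.functor.preimage g) = g := Ψ.functor.map_preimage g
      have hf : Ψ.functor.preimage g ∈ O₁ :=
        mem_endSubmonoid_of_map_mem_abs hP₁ hZ₁ hP₂ hZ₂ Ψ AX _ (by rw [hfg]; exact hg)
      have hm : ModelFrobenioid.unit (Ψ.functor.preimage g) ∈ M₁ :=
        (d₁.mem_effective_iff (op X) _).mpr ⟨_, ModelFrobenioid.of_div_eq_divB_unit_of_mem_endSubmonoid hf⟩
      refine ⟨⟨_, hm⟩, ?_⟩
      rw [hlam _ hf hm, hfg, hgu, hTT']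
    · rintro ⟨m, rfl⟩
      change T (ModelFrobenioid.unit (Ψ.functor.map (fOf m))) ∈ M₂
      exact (d₂.mem_effective_iff _ _).mpr
        ⟨_, ModelFrobenioid.of_map_eq_divB_map (Φ := d₂.Φ) (B := d₂.B) (DivB := d₂.divB) (η.inv.app AX)
          (ModelFrobenioid.of_div_eq_divB_unit_of_mem_endSubmonoid (hO _ (hfOf_mem m)))⟩
  -- extension by totality
  obtain ⟨Λ, hΛ⟩ := MulEquiv.exists_extend_of_total M₁ (d₁.isUnit_B (op X)) (d₁.effective_total (op X))
    (d₂.isUnit_B _) M₂ (d₂.effective_total _) lam hinj himage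
  refine ⟨Λ, fun f hf => ?_⟩
  have hm : ModelFrobenioid.unit f ∈ M₁ :=
    (d₁.mem_effective_iff (op X) _).mpr ⟨_, ModelFrobenioid.of_div_eq_divB_unit_of_mem_endSubmonoid hf⟩
  have h := hΛ ⟨ModelFrobenioid.unit f, hm⟩
  rw [hlam f hf hm] at h
  exact h

/-! ### §4 The natural isomorphism `Ψ_B : B₁ ≅ E^op ⋙ B₂` with the `O^▷`-clause (discharge of `(Ψ_B, hΨB)`) -/

include hP₁ hZ₁ hP₂ hZ₂ in
/-- **`Ψ` induces `Ψ_B : B₁ ⥲ B₂` over `(Ψ_Base, η)`, compatibly with `O^▷(−)`** ([FrdII] Thm. 2.4 (i) proof, p. 20: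
"`Ψ` induces … compatible isomorphisms of functors … `B₁ ⥲ B₂`").  For every equivalence `Ψ : C₁ ⥲ C₂` of `p`-adic
Frobenioids over `𝓑^temp(Πᵢ)⁰` (`Πᵢ` temp-slim tempered), every base functor `E` and every
`η : Ψ ⋙ Base₂ ≅ Base₁ ⋙ E` there is a natural isomorphism `Ψ_B : B₁ ≅ E^op ⋙ B₂` such that
`u_{Ψ f} = B₂(η_A)(Ψ_B(u_f))` for every `A ∈ Ob(C₁)` and every base-identity linear endomorphism `f` of `A` — the
`(Ψ_B, hΨB)` binder pair of the Thm. 2.4 (ii) junction (abc-iut-L1-d3's `hpos_of_equivalence`, p459104) DISCHARGED.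
[cite: MochizukiFrdII2008, Thm 2.4 (i) p.20] -/
theorem exists_psiB_of_equivalence (E : CosetCat P₁ ⥤ CosetCat P₂)
    (η : Ψ.functor ⋙ ModelFrobenioid.baseFunctor d₂.Φ d₂.B d₂.divB ≅ ModelFrobenioid.baseFunctor d₁.Φ d₁.B d₁.divB ⋙ E) :
    ∃ ΨB : d₁.B ≅ E.op ⋙ d₂.B,
      ∀ (A : d₁.frobenioid) (f : A ⟶ A), f ∈ PreFrobenioid.endSubmonoid d₁.structureFunctor A →
        ModelFrobenioid.unit (Ψ.functor.map f) =
          (d₂.B.map (η.hom.app A).op).hom (ΨB.hom.app (op A.base) (ModelFrobenioid.unit f)) := by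
  classical
  choose Λ hΛ using fun X => exists_mulEquiv_B_of_equivalence hP₁ hZ₁ hP₂ hZ₂ Ψ E η X
  have hO : ∀ (A : d₁.frobenioid) (f : A ⟶ A), f ∈ PreFrobenioid.endSubmonoid d₁.structureFunctor A →
      Ψ.functor.map f ∈ PreFrobenioid.endSubmonoid d₂.structureFunctor (Ψ.functor.obj A) :=
    fun A f hf => map_mem_endSubmonoid_of_mem_abs hP₁ hZ₁ hP₂ hZ₂ Ψ A f hf
  have hdeg : ∀ (A A' : d₁.frobenioid) (φ : A ⟶ A'), ModelFrobenioid.degFr φ = 1 →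
      ModelFrobenioid.degFr (Ψ.functor.map φ) = 1 :=
    fun A A' φ hφ => degFr_map_eq_one_of_equivalence hP₂ hZ₂ Ψ A A' φ hφ
  -- the components
  let iso : ∀ X : (CosetCat P₁)ᵒᵖ, d₁.B.obj X ≅ (E.op ⋙ d₂.B).obj X := fun X => (Λ X.unop).toCommMonCatIso
  have hiso : ∀ (X : (CosetCat P₁)ᵒᵖ) (b : d₁.B.obj X), (iso X).hom b = Λ X.unop b := fun X b => rfl
  refine ⟨NatIso.ofComponents iso ?_, ?_⟩
  · -- naturality: both composites are homomorphisms out of `B₁(X)` agreeing on the effective rational functions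
    intro X Y g
    apply CommMonCat.hom_ext
    refine MonoidHom.eq_of_eqOn_of_total
      ((MonoidHom.mrange (Algebra.GrothendieckGroup.of (M := d₁.Φ.obj X))).comap
        (Frobenioids.divB d₁.Φ d₁.B d₁.divB X)) (d₁.isUnit_B X) (d₁.effective_total X) fun b hb => ?_
    obtain ⟨c, hc⟩ := (d₁.mem_effective_iff X b).mp hb
    -- `b = u_f`, `f ∈ O^▷((X,0))`; its intertwiner `f′ ∈ O^▷((Y,0))` along `(1, g, 0, 1)` has `u_{f′} = B(g) b`
    obtain ⟨f, hf, hfu⟩ := (d₁.exists_mem_endSubmonoid_unit_eq_iff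
      (ModelFrobenioid.zeroObj d₁.Φ d₁.B d₁.divB X.unop) b).mpr ⟨c, hc⟩
    obtain ⟨f', hf', -, hf'u, -⟩ := ModelFrobenioid.exists_intertwiner_of_linear
      (ModelFrobenioid.zeroHom (Φ := d₁.Φ) (B := d₁.B) (DivB := d₁.divB) 1 g.unop) rfl hf
    change (Λ Y.unop) ((d₁.B.map g).hom b) = (d₂.B.map (E.map g.unop).op).hom ((Λ X.unop) b)
    have hg : (d₁.B.map g).hom (ModelFrobenioid.unit f) = ModelFrobenioid.unit f' := hf'u.symm
    rw [← hfu, hg, hΛ Y.unop f' hf', hΛ X.unop f hf,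
      d₁.unit_map_eq_of_unit_eq_pull d₂ Ψ.functor E η hO hdeg g.unop hf hf' hf'u]
    exact d₂.B_map_iso_conj_apply (η.app (ModelFrobenioid.zeroObj d₁.Φ d₁.B d₁.divB Y.unop)) (E.map g.unop)
      (η.inv.app (ModelFrobenioid.zeroObj d₁.Φ d₁.B d₁.divB X.unop)) _
  · -- the `O^▷`-clause at an arbitrary `A = (X, α)`
    intro A f hf
    have hdf : Algebra.GrothendieckGroup.of (ModelFrobenioid.div f) =
        Frobenioids.divB d₁.Φ d₁.B d₁.divB (op A.base) (ModelFrobenioid.unit f) :=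
      ModelFrobenioid.of_div_eq_divB_unit_of_mem_endSubmonoid hf
    obtain ⟨f₀, hf₀, hf₀u⟩ := (d₁.exists_mem_endSubmonoid_unit_eq_iff
      (ModelFrobenioid.zeroObj d₁.Φ d₁.B d₁.divB A.base) (ModelFrobenioid.unit f :)).mpr
        ⟨(ModelFrobenioid.div f :), hdf⟩
    rw [d₁.unit_map_eq_of_unit_eq_zeroObj d₂ Ψ.functor E η hO hdeg A hf hf₀ hf₀u]
    change _ = (d₂.B.map (η.hom.app A).op).hom ((Λ A.base) (ModelFrobenioid.unit f))
    rw [← hf₀u, hΛ A.base f₀ hf₀]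
    exact d₂.B_map_comp_apply _ _ _

end TwoData

end PadicFrd.Datum

end Literature.AlgebraicGeometry.Frobenioids

end
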